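import Summits.ABC.ABC.Theses.IsogenyGlueCongruence
import Summits.ABC.ABC.Theorems.EllipticGluingPrimeBound.Negative.LoadBearing
import HarnessLib

/-!
# The isotypic branch of line `Sketch` composed from its leaves (stub `stub_isotypicBranchPolyOf`)

Stub `stub_isotypicBranchPolyOf` of line `Sketch` (isotypic–Minkowski reduction) of crux U
`Summit.ABC.ABC.Theses.IsogenyGlueCongruence.EllipticGluingPrimeBound` (stmt-ABC-13919).

Setting: `E/ℚ` an AV-model of the elliptic curve `W` (`e : E(ℚ̄) ≃+ W(ℚ̄)` equivariant), `B/ℚ`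
geometrically `E`-isotypic (every non-zero geometric quotient of `B` receives a non-zero map from
`E_ℚ̄`), `ℓ` a prime at which `(E, B)` is glued (some multiplier `α ≫ β = n • 𝟙 E`, `n ≠ 0`, and
`ℓ` divides every multiplier).  The isotypic branch bounds `ℓ ≤ c · (dim B · max 1 h_F(W))^γ`
beyond a threshold `L₀`.  This file is the bookkeeping COMPOSITION of that bound from the leaves of
the branch, taken as hypotheses (the other registered stubs of the line, landing separately):
`hM` Minkowski (a prime dividing the order of a finite subgroup of `GL_r(ℤ)` is `≤ r + 1`); `hMW`
Masser–Wüstholz effective surjectivity (named-fact leaf: non-CM `W`, `ℓ > c_MW max(1, h_F(W))^γ_MW`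
⟹ `ρ̄_{W,ℓ}` surjective); `hR` rational-part reduction (glued isotypic pair, `W[ℓ]` irreducible
with scalar commutant ⟹ a `ℚ`-free isotypic `A/ℚ`, `dim A + 1 ≤ dim B`, `W[ℓ] ↪ A(ℚ̄)`); `hN`
big-image torsion core (then a finite `G ≤ GL_r(ℤ)`, `r ≤ 4 dim A`, `ℓ ∣ |G|`); `hK` CM core
(`W` CM ⟹ `ℓ ≤ c_K (dim B)²`).

Proved here (linear algebra on `W[ℓ] ≅ 𝔽_ℓ²`): (S) `surjective_irreducible_scalar_of_surjective` —
a surjective mod-`ℓ` image makes `W[ℓ]` irreducible with scalar commutant.  Then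
`nonCMIsotypicCore_of` = `hM` + (S) + `hR` + `hN` (`ℓ ≤ r + 1 ≤ 4 dim A + 1 ≤ 4 dim B + 1`), and
`isotypicBranchPoly_of_cores` assembles the bound with `L₀ = max L_N L_K`, `γ = max 2 γ_MW`,
`c = 5 + max c_MW 0 + max c_K 0`: in a glued instance `X := dim B · max(1, h_F(W)) ≥ 1`
(`dim B ≠ 0`, `EllipticGluingPrimeBound.Negative.dim_ne_zero_of_multiplier`); CM:
`ℓ ≤ c_K (dim B)² ≤ max c_K 0 · X^γ`; non-CM below the Masser–Wüstholz threshold: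
`ℓ ≤ c_MW max(1,h)^γ_MW ≤ max c_MW 0 · X^γ`; beyond it: surjective image, `ℓ ≤ 4 dim B + 1 ≤ 5 X^γ`.
`stub_isotypicBranchPolyOf` is the registered signature, by name from the three.

Tree inputs (all proved): `Literature.NumberTheory.EllipticCurves.natCard_geomTorsion_int_eq_sq`
(`#W[ℓ] = ℓ²`), `WeierstrassCurve.galoisRepTorsion_apply`, `AddSubgroup.torsionBy.zmodModule`,
`Module.natCard_eq_pow_finrank`, `basisOfLinearIndependentOfCardEqFinrank`,
`LinearIndependent.pair_iff'`, `EllipticGluingPrimeBound.Negative.dim_ne_zero_of_multiplier`;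
Mathlib `Real.one_le_rpow`, `Real.rpow_le_rpow(_of_exponent_le)`, `Real.rpow_two`.  No cited facts.
-/

-- `Summit.<Summit>.<Problem>` is the mandated summit-side namespace (CONVENTIONS §2); for the
-- single-conjunct summit `ABC` the two coincide, so the duplicate `ABC.ABC` is deliberate.
set_option linter.dupNamespace false

namespace Summit.ABC.ABC.Theorems.IsotypicMinkowski

open CategoryTheory CategoryTheory.Limits AlgebraicGeometry
open Literature.AlgebraicGeometry.Motives
open Summit.ABC.ABC.Theses.IsogenyGlueCongruence

/-- **(S) Surjective image ⟹ absolutely irreducible.** If `ρ̄_{W,ℓ} : Γ_ℚ → Aut(W[ℓ])` is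
surjective then `W[ℓ]` is irreducible and every `Γ_ℚ`-equivariant additive endomorphism of `W[ℓ]`
is multiplication by an integer (`W[ℓ] ≅ 𝔽_ℓ²` by `natCard_geomTorsion_int_eq_sq`; a line is moved
by some automorphism, namely the swap of a basis through it; an endomorphism commuting with a
shear and a swap is scalar).  Pure linear algebra over `ZMod ℓ`. [folklore] -/
theorem surjective_irreducible_scalar_of_surjective {W : WeierstrassCurve ℚ} [W.IsElliptic]
    {ℓ : ℕ} (hℓ : ℓ.Prime) (hs : W.HasSurjectiveModNGaloisRep ℓ) :
    W.HasIrreducibleModPGaloisRep ℓ ∧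
      ∀ f : W.geomTorsion ℓ →+ W.geomTorsion ℓ,
        (∀ (σ : Field.absoluteGaloisGroup ℚ) (P : W.geomTorsion ℓ), f (σ • P) = σ • f P) →
        ∃ n : ℤ, ∀ P : W.geomTorsion ℓ, f P = n • P := by
  classical
  haveI : Fact ℓ.Prime := ⟨hℓ⟩
  -- the `𝔽_ℓ`-structure on `V = W[ℓ]`, of cardinality `ℓ²`, hence of dimension `2`
  letI : Module (ZMod ℓ) (W.geomTorsion ℓ) := AddSubgroup.torsionBy.zmodModule
  have hcard : Nat.card (W.geomTorsion ℓ) = ℓ ^ 2 := by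
    have h := Literature.NumberTheory.EllipticCurves.natCard_geomTorsion_int_eq_sq W
      (n := (ℓ : ℤ)) (by exact_mod_cast hℓ.ne_zero)
    rwa [Int.natAbs_natCast] at h
  haveI : Finite (W.geomTorsion ℓ) :=
    Nat.finite_of_card_ne_zero (by rw [hcard]; exact pow_ne_zero 2 hℓ.ne_zero)
  haveI : Module.Finite (ZMod ℓ) (W.geomTorsion ℓ) := Module.Finite.of_finite
  have hrank : Module.finrank (ZMod ℓ) (W.geomTorsion ℓ) = 2 := by
    have h := Module.natCard_eq_pow_finrank (K := ZMod ℓ) (V := W.geomTorsion ℓ)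
    rw [hcard, Nat.card_zmod] at h
    exact (Nat.pow_right_injective hℓ.two_le h).symm
  -- every additive automorphism of `W[ℓ]` is a Galois element
  have hs' : Function.Surjective (W.galoisRepTorsion ℓ) := hs
  have hgal : ∀ φ : W.geomTorsion ℓ ≃ₗ[ZMod ℓ] W.geomTorsion ℓ,
      ∃ σ : Field.absoluteGaloisGroup ℚ, ∀ P : W.geomTorsion ℓ, σ • P = φ P := fun φ ↦ by
    obtain ⟨σ, hσ⟩ := hs' (Multiplicative.ofAdd φ.toAddEquiv)
    refine ⟨σ, fun P ↦ ?_⟩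
    have h := WeierstrassCurve.galoisRepTorsion_apply W ℓ σ P
    rw [hσ] at h
    simpa using h.symm
  -- a basis from a linearly independent pair
  have mkBasis : ∀ {v : Fin 2 → W.geomTorsion ℓ}, LinearIndependent (ZMod ℓ) v →
      ∃ b : Module.Basis (Fin 2) (ZMod ℓ) (W.geomTorsion ℓ), ⇑b = v := fun {v} hv ↦
    ⟨basisOfLinearIndependentOfCardEqFinrank hv (by rw [Fintype.card_fin, hrank]),
      coe_basisOfLinearIndependentOfCardEqFinrank _ _⟩
  refine ⟨fun H hH ↦ ?_, fun f hf ↦ ?_⟩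
  · -- irreducibility: a proper non-zero stable subgroup contains `P ≠ 0` and misses some `Q`;
    -- the swap of the basis `(P, Q)` is a Galois element moving `P` to `Q`
    by_contra hcon
    push Not at hcon
    obtain ⟨hbot, htop⟩ := hcon
    obtain ⟨P, hPH, hP0⟩ : ∃ P ∈ H, P ≠ 0 := by
      by_contra h
      push Not at h
      exact hbot ((AddSubgroup.eq_bot_iff_forall _).2 h)
    obtain ⟨Q, hQH⟩ : ∃ Q, Q ∉ H := by
      by_contra h
      push Not at h
      exact htop ((AddSubgroup.eq_top_iff' _).2 h)
    have hli : LinearIndependent (ZMod ℓ) ![P, Q] :=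
      (LinearIndependent.pair_iff' hP0).2 fun s hs ↦ hQH (hs ▸ ZMod.smul_mem hPH s)
    obtain ⟨b, hb⟩ := mkBasis hli
    have hb0 : b 0 = P := by rw [hb]; rfl
    have hb1 : b 1 = Q := by rw [hb]; rfl
    obtain ⟨σ, hσ⟩ := hgal (b.equiv b (Equiv.swap 0 1))
    have h := hH σ P hPH
    rw [hσ P, ← hb0, Module.Basis.equiv_apply, Equiv.swap_apply_left, hb1] at h
    exact hQH h
  · -- scalar commutant: `f` commutes with the shear `(P, Q) ↦ (P, P + Q)` and the swap
    have hcomm : ∀ (φ : W.geomTorsion ℓ ≃ₗ[ZMod ℓ] W.geomTorsion ℓ) (P : W.geomTorsion ℓ),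
        f (φ P) = φ (f P) := by
      intro φ P
      obtain ⟨σ, hσ⟩ := hgal φ
      have h := hf σ P
      rwa [hσ P, hσ (f P)] at h
    have hlin : ∀ (x : ZMod ℓ) (v : W.geomTorsion ℓ), f (x • v) = x • f v :=
      fun x v ↦ ZMod.map_smul f x v
    let b : Module.Basis (Fin 2) (ZMod ℓ) (W.geomTorsion ℓ) :=
      Module.finBasisOfFinrankEq (ZMod ℓ) (W.geomTorsion ℓ) hrank
    have hbli : LinearIndependent (ZMod ℓ) ![b 0, b 1] := by
      convert b.linearIndependent using 1
      funext i
      fin_cases i <;> rfl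
    have hli : LinearIndependent (ZMod ℓ) ![b 0, b 0 + b 1] :=
      (LinearIndependent.pair_iff' (b.ne_zero 0)).2 fun s hs ↦
        (LinearIndependent.pair_iff' (b.ne_zero 0)).1 hbli (s - 1)
          (by rw [sub_smul, one_smul, hs, add_sub_cancel_left])
    obtain ⟨b', hb'⟩ := mkBasis hli
    have hb'0 : b' 0 = b 0 := by rw [hb']; rfl
    have hb'1 : b' 1 = b 0 + b 1 := by rw [hb']; rfl
    -- coordinates of `f (b 0)`
    set a := b.repr (f (b 0)) 0 with ha
    set c := b.repr (f (b 0)) 1 with hc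
    have hfP : f (b 0) = a • b 0 + c • b 1 := by
      have h := b.sum_repr (f (b 0))
      rw [Fin.sum_univ_two] at h
      exact h.symm
    -- the shear kills `c`
    have hc0 : c = 0 := by
      have h := hcomm (b.equiv b' (Equiv.refl _)) (b 0)
      rw [Module.Basis.equiv_apply, Equiv.refl_apply, hb'0, hfP, map_add, map_smul, map_smul,
        Module.Basis.equiv_apply, Module.Basis.equiv_apply, Equiv.refl_apply, Equiv.refl_apply,
        hb'0, hb'1, smul_add, ← add_assoc, add_comm (a • b 0) (c • b 0), add_assoc] at h
      -- h : a • b 0 + c • b 1 = c • b 0 + (a • b 0 + c • b 1)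
      exact (smul_eq_zero.1 (right_eq_add.1 h)).resolve_right (b.ne_zero 0)
    have hfP' : f (b 0) = a • b 0 := by rw [hfP, hc0, zero_smul, add_zero]
    -- the swap transports `f (b 0) = a • b 0` to `f (b 1) = a • b 1`
    have hfQ : f (b 1) = a • b 1 := by
      have h := hcomm (b.equiv b (Equiv.swap 0 1)) (b 0)
      rwa [Module.Basis.equiv_apply, Equiv.swap_apply_left, hfP', map_smul,
        Module.Basis.equiv_apply, Equiv.swap_apply_left] at h
    refine ⟨((a.val : ℕ) : ℤ), fun P ↦ ?_⟩
    have hP := b.sum_repr P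
    rw [Fin.sum_univ_two] at hP
    calc f P = f (b.repr P 0 • b 0 + b.repr P 1 • b 1) := by rw [hP]
      _ = a • P := by
          rw [map_add, hlin, hlin, hfP', hfQ, smul_comm _ a, smul_comm _ a, ← smul_add, hP]
      _ = ((a.val : ℕ) : ℤ) • P := by
          rw [natCast_zsmul, ← Nat.cast_smul_eq_nsmul (ZMod ℓ), ZMod.natCast_zmod_val]

/-- **(N\*) The non-CM (big-image) isotypic core on `B`, from Minkowski (`hM`) + (S) + the
rational-part reduction (`hR`) + the big-image torsion core (`hN`):** if `ρ̄_{W,ℓ}` is surjective,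
`B` is geometrically `E`-isotypic and `(E, B)` is glued at the prime `ℓ > L₀`, then
`ℓ ≤ 4 · dim B + 1` (`ℓ ≤ r + 1`, `r ≤ 4 dim A`, `dim A + 1 ≤ dim B`). [folklore] -/
theorem nonCMIsotypicCore_of
    (hM : ∀ (r ℓ : ℕ), ℓ.Prime → ∀ G : Subgroup (Matrix.GeneralLinearGroup (Fin r) ℤ),
      Finite G → ℓ ∣ Nat.card G → ℓ ≤ r + 1)
    (hR : ∀ (W : WeierstrassCurve ℚ) [W.IsElliptic] (E B : AbelianVariety.{0} ℚ)
      (e : E.geomPoints ≃+ W.geomPoints),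
      (∀ (σ : Field.absoluteGaloisGroup ℚ) (P : E.geomPoints), e (σ • P) = σ • e P) →
      (∀ (C : AbelianVariety.{0} (AlgebraicClosure ℚ))
          (g : B.baseChange (AlgebraicClosure ℚ) ⟶ C),
          Surjective (AbelianVariety.Hom.toSchemeHom g) → C.dim ≠ 0 →
          ∃ f : E.baseChange (AlgebraicClosure ℚ) ⟶ C, f ≠ 0) →
      ∀ ℓ : ℕ, ℓ.Prime → W.HasIrreducibleModPGaloisRep ℓ →
      (∀ f : W.geomTorsion ℓ →+ W.geomTorsion ℓ,
        (∀ (σ : Field.absoluteGaloisGroup ℚ) (P : W.geomTorsion ℓ), f (σ • P) = σ • f P) →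
        ∃ n : ℤ, ∀ P : W.geomTorsion ℓ, f P = n • P) →
      (∃ (α : E ⟶ B) (β : B ⟶ E) (n : ℤ), n ≠ 0 ∧ α ≫ β = n • 𝟙 E) →
      (∀ (α : E ⟶ B) (β : B ⟶ E) (n : ℤ), α ≫ β = n • 𝟙 E → (ℓ : ℤ) ∣ n) →
      ∃ A : AbelianVariety.{0} ℚ, A.dim + 1 ≤ B.dim ∧
        (∀ (C : AbelianVariety.{0} (AlgebraicClosure ℚ))
            (g : A.baseChange (AlgebraicClosure ℚ) ⟶ C),
            Surjective (AbelianVariety.Hom.toSchemeHom g) → C.dim ≠ 0 →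
            ∃ f : E.baseChange (AlgebraicClosure ℚ) ⟶ C, f ≠ 0) ∧
        (∀ f : E ⟶ A, f = 0) ∧
        ∃ ι : W.geomTorsion ℓ →+ A.geomPoints, Function.Injective ι ∧
          ∀ (σ : Field.absoluteGaloisGroup ℚ) (P : W.geomTorsion ℓ), ι (σ • P) = σ • ι P)
    (hN : ∃ L₀ : ℕ, ∀ (W : WeierstrassCurve ℚ) [W.IsElliptic] (E A : AbelianVariety.{0} ℚ)
      (e : E.geomPoints ≃+ W.geomPoints),
      (∀ (σ : Field.absoluteGaloisGroup ℚ) (P : E.geomPoints), e (σ • P) = σ • e P) →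
      (∀ (C : AbelianVariety.{0} (AlgebraicClosure ℚ))
          (g : A.baseChange (AlgebraicClosure ℚ) ⟶ C),
          Surjective (AbelianVariety.Hom.toSchemeHom g) → C.dim ≠ 0 →
          ∃ f : E.baseChange (AlgebraicClosure ℚ) ⟶ C, f ≠ 0) →
      (∀ f : E ⟶ A, f = 0) →
      ∀ ℓ : ℕ, ℓ.Prime → L₀ < ℓ → W.HasSurjectiveModNGaloisRep ℓ →
      (∃ ι : W.geomTorsion ℓ →+ A.geomPoints, Function.Injective ι ∧
        ∀ (σ : Field.absoluteGaloisGroup ℚ) (P : W.geomTorsion ℓ), ι (σ • P) = σ • ι P) →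
        ∃ (r : ℕ) (G : Subgroup (Matrix.GeneralLinearGroup (Fin r) ℤ)),
          r ≤ 4 * A.dim ∧ Finite G ∧ ℓ ∣ Nat.card G) :
    ∃ L₀ : ℕ, ∀ (W : WeierstrassCurve ℚ) [W.IsElliptic] (E B : AbelianVariety.{0} ℚ)
      (e : E.geomPoints ≃+ W.geomPoints),
      (∀ (σ : Field.absoluteGaloisGroup ℚ) (P : E.geomPoints), e (σ • P) = σ • e P) →
      (∀ (C : AbelianVariety.{0} (AlgebraicClosure ℚ))
          (g : B.baseChange (AlgebraicClosure ℚ) ⟶ C),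
          Surjective (AbelianVariety.Hom.toSchemeHom g) → C.dim ≠ 0 →
          ∃ f : E.baseChange (AlgebraicClosure ℚ) ⟶ C, f ≠ 0) →
      ∀ ℓ : ℕ, ℓ.Prime → L₀ < ℓ → W.HasSurjectiveModNGaloisRep ℓ →
      (∃ (α : E ⟶ B) (β : B ⟶ E) (n : ℤ), n ≠ 0 ∧ α ≫ β = n • 𝟙 E) →
      (∀ (α : E ⟶ B) (β : B ⟶ E) (n : ℤ), α ≫ β = n • 𝟙 E → (ℓ : ℤ) ∣ n) →
        ℓ ≤ 4 * B.dim + 1 := by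
  obtain ⟨L₀, hN⟩ := hN
  refine ⟨L₀, ?_⟩
  intro W _ E B e he hiso ℓ hℓ hL hsurj hex hall
  obtain ⟨hirr, hsc⟩ := surjective_irreducible_scalar_of_surjective hℓ hsurj
  obtain ⟨A, hA, hisoA, hfree, hι⟩ := hR W E B e he hiso ℓ hℓ hirr hsc hex hall
  obtain ⟨r, G, hr, hG, hdvd⟩ := hN W E A e he hisoA hfree ℓ hℓ hL hsurj hι
  have h1 := hM r ℓ hℓ G hG hdvd
  omega

/-- **Composition of the isotypic branch from the cores: (MW) + (N\*) + (K) ⟹ the registered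
conclusion**, with `L₀ = max L_N L_K`, `γ' = max 2 γ_MW`, `c' = 5 + max c_MW 0 + max c_K 0`.  In a
glued instance `X := dim B · max(1, h_F(W)) ≥ 1`; CM: `ℓ ≤ c_K (dim B)² ≤ max c_K 0 · X^{γ'}`;
non-CM below the Masser–Wüstholz threshold: `ℓ ≤ c_MW max(1,h)^γ ≤ max c_MW 0 · X^{γ'}`; non-CM
beyond it: surjective image, so `ℓ ≤ 4 dim B + 1 ≤ 5 X ≤ 5 X^{γ'}`. [folklore] -/
theorem isotypicBranchPoly_of_cores
    (hMW : ∃ (c γ : ℝ), 0 ≤ γ ∧ ∀ (W : WeierstrassCurve ℚ) [W.IsElliptic], ¬ W.HasCM →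
      ∀ ℓ : ℕ, ℓ.Prime → c * (max 1 W.stableFaltingsHeight) ^ γ < ℓ →
        W.HasSurjectiveModNGaloisRep ℓ)
    (hN : ∃ L₀ : ℕ, ∀ (W : WeierstrassCurve ℚ) [W.IsElliptic] (E B : AbelianVariety.{0} ℚ)
      (e : E.geomPoints ≃+ W.geomPoints),
      (∀ (σ : Field.absoluteGaloisGroup ℚ) (P : E.geomPoints), e (σ • P) = σ • e P) →
      (∀ (C : AbelianVariety.{0} (AlgebraicClosure ℚ))
          (g : B.baseChange (AlgebraicClosure ℚ) ⟶ C),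
          Surjective (AbelianVariety.Hom.toSchemeHom g) → C.dim ≠ 0 →
          ∃ f : E.baseChange (AlgebraicClosure ℚ) ⟶ C, f ≠ 0) →
      ∀ ℓ : ℕ, ℓ.Prime → L₀ < ℓ → W.HasSurjectiveModNGaloisRep ℓ →
      (∃ (α : E ⟶ B) (β : B ⟶ E) (n : ℤ), n ≠ 0 ∧ α ≫ β = n • 𝟙 E) →
      (∀ (α : E ⟶ B) (β : B ⟶ E) (n : ℤ), α ≫ β = n • 𝟙 E → (ℓ : ℤ) ∣ n) →
        ℓ ≤ 4 * B.dim + 1)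
    (hK : ∃ (L₀ : ℕ) (c : ℝ), ∀ (W : WeierstrassCurve ℚ) [W.IsElliptic]
      (E B : AbelianVariety.{0} ℚ) (e : E.geomPoints ≃+ W.geomPoints),
      (∀ (σ : Field.absoluteGaloisGroup ℚ) (P : E.geomPoints), e (σ • P) = σ • e P) →
      W.HasCM →
      (∀ (C : AbelianVariety.{0} (AlgebraicClosure ℚ))
          (g : B.baseChange (AlgebraicClosure ℚ) ⟶ C),
          Surjective (AbelianVariety.Hom.toSchemeHom g) → C.dim ≠ 0 →
          ∃ f : E.baseChange (AlgebraicClosure ℚ) ⟶ C, f ≠ 0) →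
      ∀ ℓ : ℕ, ℓ.Prime → L₀ < ℓ →
      (∃ (α : E ⟶ B) (β : B ⟶ E) (n : ℤ), n ≠ 0 ∧ α ≫ β = n • 𝟙 E) →
      (∀ (α : E ⟶ B) (β : B ⟶ E) (n : ℤ), α ≫ β = n • 𝟙 E → (ℓ : ℤ) ∣ n) →
        (ℓ : ℝ) ≤ c * (B.dim : ℝ) ^ 2) :
    ∃ (L₀ : ℕ) (γ c : ℝ), 0 ≤ γ ∧ ∀ (W : WeierstrassCurve ℚ) [W.IsElliptic]
      (E B : AbelianVariety.{0} ℚ) (e : E.geomPoints ≃+ W.geomPoints),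
      (∀ (σ : Field.absoluteGaloisGroup ℚ) (P : E.geomPoints), e (σ • P) = σ • e P) →
      (∀ (C : AbelianVariety.{0} (AlgebraicClosure ℚ))
          (g : B.baseChange (AlgebraicClosure ℚ) ⟶ C),
          Surjective (AbelianVariety.Hom.toSchemeHom g) → C.dim ≠ 0 →
          ∃ f : E.baseChange (AlgebraicClosure ℚ) ⟶ C, f ≠ 0) →
      ∀ ℓ : ℕ, ℓ.Prime → L₀ < ℓ →
      (∃ (α : E ⟶ B) (β : B ⟶ E) (n : ℤ), n ≠ 0 ∧ α ≫ β = n • 𝟙 E) →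
      (∀ (α : E ⟶ B) (β : B ⟶ E) (n : ℤ), α ≫ β = n • 𝟙 E → (ℓ : ℤ) ∣ n) →
        (ℓ : ℝ) ≤ c * ((B.dim : ℝ) * max 1 W.stableFaltingsHeight) ^ γ := by
  obtain ⟨c, γ, hγ, hMW⟩ := hMW
  obtain ⟨L₁, hN⟩ := hN
  obtain ⟨L₂, cK, hK⟩ := hK
  refine ⟨max L₁ L₂, max 2 γ, 5 + max c 0 + max cK 0, zero_le_two.trans (le_max_left _ _), ?_⟩
  intro W _ E B e he hiso ℓ hℓ hL₀ hex hall
  set κ' : ℝ := max 2 γ with hκ'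
  set X : ℝ := (B.dim : ℝ) * max 1 W.stableFaltingsHeight with hX
  have hdim : (1 : ℝ) ≤ B.dim := Nat.one_le_cast.2 <| Nat.one_le_iff_ne_zero.2
    (EllipticGluingPrimeBound.Negative.dim_ne_zero_of_multiplier e hex)
  have hd0 : (0 : ℝ) ≤ B.dim := zero_le_one.trans hdim
  have hh : (1 : ℝ) ≤ max 1 W.stableFaltingsHeight := le_max_left _ _
  have hm0 : (0 : ℝ) ≤ max 1 W.stableFaltingsHeight := zero_le_one.trans hh
  have hX1 : 1 ≤ X := by rw [hX]; nlinarith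
  have hκ'2 : 2 ≤ κ' := le_max_left _ _
  have hκ'1 : 1 ≤ κ' := by linarith
  have hXpow1 : 1 ≤ X ^ κ' := Real.one_le_rpow hX1 (by linarith)
  have hXpow0 : 0 ≤ X ^ κ' := zero_le_one.trans hXpow1
  have hXle : X ≤ X ^ κ' := by
    simpa only [Real.rpow_one] using Real.rpow_le_rpow_of_exponent_le hX1 hκ'1
  have hX2le : X ^ 2 ≤ X ^ κ' := by
    simpa only [Real.rpow_two] using Real.rpow_le_rpow_of_exponent_le hX1 hκ'2
  have hdimX : (B.dim : ℝ) ≤ X := by rw [hX]; exact le_mul_of_one_le_right hd0 hh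
  have hmX : max 1 W.stableFaltingsHeight ≤ X := by rw [hX]; exact le_mul_of_one_le_left hm0 hdim
  have hc0 : (0 : ℝ) ≤ max c 0 := le_max_right _ _
  have hcK0 : (0 : ℝ) ≤ max cK 0 := le_max_right _ _
  have hL₁ : L₁ < ℓ := lt_of_le_of_lt (le_max_left _ _) hL₀
  have hL₂ : L₂ < ℓ := lt_of_le_of_lt (le_max_right _ _) hL₀
  have key : ∀ K : ℝ, K ≤ 5 + max c 0 + max cK 0 → (ℓ : ℝ) ≤ K * X ^ κ' →
      (ℓ : ℝ) ≤ (5 + max c 0 + max cK 0) * X ^ κ' :=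
    fun K hK h ↦ h.trans (mul_le_mul_of_nonneg_right hK hXpow0)
  by_cases hCM : W.HasCM
  · have h1 := hK W E B e he hCM hiso ℓ hℓ hL₂ hex hall
    refine key (max cK 0) (by linarith) ?_
    calc (ℓ : ℝ) ≤ cK * (B.dim : ℝ) ^ 2 := h1
      _ ≤ max cK 0 * (B.dim : ℝ) ^ 2 :=
          mul_le_mul_of_nonneg_right (le_max_left _ _) (by positivity)
      _ ≤ max cK 0 * X ^ 2 := mul_le_mul_of_nonneg_left (by gcongr) hcK0
      _ ≤ max cK 0 * X ^ κ' := mul_le_mul_of_nonneg_left hX2le hcK0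
  · by_cases hsmall : (ℓ : ℝ) ≤ c * (max 1 W.stableFaltingsHeight) ^ γ
    · refine key (max c 0) (by linarith) ?_
      calc (ℓ : ℝ) ≤ c * (max 1 W.stableFaltingsHeight) ^ γ := hsmall
        _ ≤ max c 0 * (max 1 W.stableFaltingsHeight) ^ γ :=
            mul_le_mul_of_nonneg_right (le_max_left _ _) (Real.rpow_nonneg hm0 γ)
        _ ≤ max c 0 * X ^ γ := mul_le_mul_of_nonneg_left (Real.rpow_le_rpow hm0 hmX hγ) hc0
        _ ≤ max c 0 * X ^ κ' :=
            mul_le_mul_of_nonneg_left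
              (Real.rpow_le_rpow_of_exponent_le hX1 (le_max_right _ _)) hc0
    · push Not at hsmall
      have hsurj := hMW W hCM ℓ hℓ hsmall
      have h1 := hN W E B e he hiso ℓ hℓ hL₁ hsurj hex hall
      have h1' : (ℓ : ℝ) ≤ 4 * (B.dim : ℝ) + 1 := by exact_mod_cast h1
      refine key 5 (by linarith) ?_
      calc (ℓ : ℝ) ≤ 5 * (B.dim : ℝ) := by linarith
        _ ≤ 5 * X := by linarith
        _ ≤ 5 * X ^ κ' := by linarith

/-- **Stub `stub_isotypicBranchPolyOf` (composition of the isotypic branch from its leaves):**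
Minkowski (`hM`) + Masser–Wüstholz surjectivity (`hMW`) + rational-part reduction (`hR`) +
big-image torsion core (`hN`) + CM core (`hK`) ⟹ the polynomial isotypic bound
`ℓ ≤ c · (dim B · max 1 h_F(W))^γ` beyond `L₀`, with `L₀ = max L_N L_K`, `γ = max 2 γ_MW`,
`c = 5 + max c_MW 0 + max c_K 0` (non-CM beyond the Masser–Wüstholz threshold: surjective image,
`W[ℓ]` irreducible with scalar commutant by (S), then `hR`, `hN`, Minkowski: `ℓ ≤ 4 dim B + 1`;
non-CM below it: the threshold itself; CM: `hK`).  By name: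
`isotypicBranchPoly_of_cores hMW (nonCMIsotypicCore_of hM hR hN) hK`. [folklore] -/
theorem stub_isotypicBranchPolyOf
    (hM : ∀ (r ℓ : ℕ), ℓ.Prime → ∀ G : Subgroup (Matrix.GeneralLinearGroup (Fin r) ℤ),
      Finite G → ℓ ∣ Nat.card G → ℓ ≤ r + 1)
    (hMW : ∃ (c γ : ℝ), 0 ≤ γ ∧ ∀ (W : WeierstrassCurve ℚ) [W.IsElliptic], ¬ W.HasCM →
      ∀ ℓ : ℕ, ℓ.Prime → c * (max 1 W.stableFaltingsHeight) ^ γ < ℓ →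
        W.HasSurjectiveModNGaloisRep ℓ)
    (hR : ∀ (W : WeierstrassCurve ℚ) [W.IsElliptic] (E B : AbelianVariety.{0} ℚ)
      (e : E.geomPoints ≃+ W.geomPoints),
      (∀ (σ : Field.absoluteGaloisGroup ℚ) (P : E.geomPoints), e (σ • P) = σ • e P) →
      (∀ (C : AbelianVariety.{0} (AlgebraicClosure ℚ))
          (g : B.baseChange (AlgebraicClosure ℚ) ⟶ C),
          Surjective (AbelianVariety.Hom.toSchemeHom g) → C.dim ≠ 0 →
          ∃ f : E.baseChange (AlgebraicClosure ℚ) ⟶ C, f ≠ 0) →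
      ∀ ℓ : ℕ, ℓ.Prime → W.HasIrreducibleModPGaloisRep ℓ →
      (∀ f : W.geomTorsion ℓ →+ W.geomTorsion ℓ,
        (∀ (σ : Field.absoluteGaloisGroup ℚ) (P : W.geomTorsion ℓ), f (σ • P) = σ • f P) →
        ∃ n : ℤ, ∀ P : W.geomTorsion ℓ, f P = n • P) →
      (∃ (α : E ⟶ B) (β : B ⟶ E) (n : ℤ), n ≠ 0 ∧ α ≫ β = n • 𝟙 E) →
      (∀ (α : E ⟶ B) (β : B ⟶ E) (n : ℤ), α ≫ β = n • 𝟙 E → (ℓ : ℤ) ∣ n) →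
      ∃ A : AbelianVariety.{0} ℚ, A.dim + 1 ≤ B.dim ∧
        (∀ (C : AbelianVariety.{0} (AlgebraicClosure ℚ))
            (g : A.baseChange (AlgebraicClosure ℚ) ⟶ C),
            Surjective (AbelianVariety.Hom.toSchemeHom g) → C.dim ≠ 0 →
            ∃ f : E.baseChange (AlgebraicClosure ℚ) ⟶ C, f ≠ 0) ∧
        (∀ f : E ⟶ A, f = 0) ∧
        ∃ ι : W.geomTorsion ℓ →+ A.geomPoints, Function.Injective ι ∧
          ∀ (σ : Field.absoluteGaloisGroup ℚ) (P : W.geomTorsion ℓ), ι (σ • P) = σ • ι P)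
    (hN : ∃ L₀ : ℕ, ∀ (W : WeierstrassCurve ℚ) [W.IsElliptic] (E A : AbelianVariety.{0} ℚ)
      (e : E.geomPoints ≃+ W.geomPoints),
      (∀ (σ : Field.absoluteGaloisGroup ℚ) (P : E.geomPoints), e (σ • P) = σ • e P) →
      (∀ (C : AbelianVariety.{0} (AlgebraicClosure ℚ))
          (g : A.baseChange (AlgebraicClosure ℚ) ⟶ C),
          Surjective (AbelianVariety.Hom.toSchemeHom g) → C.dim ≠ 0 →
          ∃ f : E.baseChange (AlgebraicClosure ℚ) ⟶ C, f ≠ 0) →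
      (∀ f : E ⟶ A, f = 0) →
      ∀ ℓ : ℕ, ℓ.Prime → L₀ < ℓ → W.HasSurjectiveModNGaloisRep ℓ →
      (∃ ι : W.geomTorsion ℓ →+ A.geomPoints, Function.Injective ι ∧
        ∀ (σ : Field.absoluteGaloisGroup ℚ) (P : W.geomTorsion ℓ), ι (σ • P) = σ • ι P) →
        ∃ (r : ℕ) (G : Subgroup (Matrix.GeneralLinearGroup (Fin r) ℤ)),
          r ≤ 4 * A.dim ∧ Finite G ∧ ℓ ∣ Nat.card G)
    (hK : ∃ (L₀ : ℕ) (c : ℝ), ∀ (W : WeierstrassCurve ℚ) [W.IsElliptic]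
      (E B : AbelianVariety.{0} ℚ) (e : E.geomPoints ≃+ W.geomPoints),
      (∀ (σ : Field.absoluteGaloisGroup ℚ) (P : E.geomPoints), e (σ • P) = σ • e P) →
      W.HasCM →
      (∀ (C : AbelianVariety.{0} (AlgebraicClosure ℚ))
          (g : B.baseChange (AlgebraicClosure ℚ) ⟶ C),
          Surjective (AbelianVariety.Hom.toSchemeHom g) → C.dim ≠ 0 →
          ∃ f : E.baseChange (AlgebraicClosure ℚ) ⟶ C, f ≠ 0) →
      ∀ ℓ : ℕ, ℓ.Prime → L₀ < ℓ →
      (∃ (α : E ⟶ B) (β : B ⟶ E) (n : ℤ), n ≠ 0 ∧ α ≫ β = n • 𝟙 E) →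
      (∀ (α : E ⟶ B) (β : B ⟶ E) (n : ℤ), α ≫ β = n • 𝟙 E → (ℓ : ℤ) ∣ n) →
        (ℓ : ℝ) ≤ c * (B.dim : ℝ) ^ 2) :
    ∃ (L₀ : ℕ) (γ c : ℝ), 0 ≤ γ ∧ ∀ (W : WeierstrassCurve ℚ) [W.IsElliptic]
      (E B : AbelianVariety.{0} ℚ) (e : E.geomPoints ≃+ W.geomPoints),
      (∀ (σ : Field.absoluteGaloisGroup ℚ) (P : E.geomPoints), e (σ • P) = σ • e P) →
      (∀ (C : AbelianVariety.{0} (AlgebraicClosure ℚ))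
          (g : B.baseChange (AlgebraicClosure ℚ) ⟶ C),
          Surjective (AbelianVariety.Hom.toSchemeHom g) → C.dim ≠ 0 →
          ∃ f : E.baseChange (AlgebraicClosure ℚ) ⟶ C, f ≠ 0) →
      ∀ ℓ : ℕ, ℓ.Prime → L₀ < ℓ →
      (∃ (α : E ⟶ B) (β : B ⟶ E) (n : ℤ), n ≠ 0 ∧ α ≫ β = n • 𝟙 E) →
      (∀ (α : E ⟶ B) (β : B ⟶ E) (n : ℤ), α ≫ β = n • 𝟙 E → (ℓ : ℤ) ∣ n) →
        (ℓ : ℝ) ≤ c * ((B.dim : ℝ) * max 1 W.stableFaltingsHeight) ^ γ :=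
  isotypicBranchPoly_of_cores hMW (nonCMIsotypicCore_of hM hR hN) hK

end Summit.ABC.ABC.Theorems.IsotypicMinkowski
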